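import Summits.MatrixMultiplication.MatrixMultiplication.Theorems.SaturationLadderTwinCeiling
import HarnessLib

/-!
# SaturationLadder — the twin-class endpoint: `Base((3125/128)^{1/3})` by the diagonal of the pencil

Route `SaturationLadder` (sub-problem `MatrixMultiplication`), crux `SubexpSaturation`
(stmt-MatrixMultiplication-25909) `⟺ ∀ θ > 1, Base(θ)`
(`SaturationLadderBaseFamily.subexpSaturation_iff_forall_base`), where
`Base(θ) :≡ ∃ C, ∀ t ∈ [0,1), ∃ r, 1 ≤ r ≤ C · θ^{1/(1−t)} ∧ ω(1,t,r) ≤ 1 + r` (written out verbatim;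
no definition is introduced).

State before this file (`SaturationLadderTwinCeiling`): `Base(θ)` is a theorem for every `θ > 0` with
`θ³ > 3125/128` (`base_of_cube_gt`), read off the one-parameter pencil `κ = p/q` of STAGE-2 twin
families, each member giving the base `2^{1 + 2κ/3}` for `κ` STRICTLY above the `Y`-threshold
`κ₀ = (5/2) log₂(5/4) = 0.8048…`; no single pencil member reaches the class's design limit
`2^{1 + 2κ₀/3} = (3125/128)^{1/3} = 2.90099…` itself, so the endpoint was left open
(`subexpSaturation_iff_base_cube_le : SubexpSaturation ⟺ ∀ θ > 1, θ³ ≤ 3125/128 → Base θ`).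

This file closes the endpoint IN CLASS, by a diagonal through the pencil: at level `j` take the member
`q = j`, `p = p_j := ⌈(30 + (5/2) j log(5/4)) / log 2⌉`, i.e. `κ_j = p_j/j ∈ [κ₀ + 30/(j log 2), κ₀ + 45/j]`.
Then `j · δ(κ_j) ≥ 30` holds BY CONSTRUCTION (`diag_delta`), so the landed entropy hypotheses
`paramY` / `paramX` apply at every level `j ≥ 1000`, while the growth deficit of the member against the
limit base is bounded: `2^{j+2} ≤ 2^{46} · θ^{1/(1−t_j)}` whenever `θ³ ≥ 3125/128` (`diag_growth`: the
exponent comparison is `(j − 44)(3j + 2p_j) log 2 ≤ j² log(3125/128)`, which is the identity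
`log(3125/128) = 5 log(5/4) + 3 log 2` plus `2 p_j log 2 ≤ 60 + 5 j log(5/4) + 2 log 2`).  Hence:

* `base_of_cube_ge` : **`Base(θ)` for every `θ > 0` with `θ³ ≥ 3125/128`** (constant `C = 2^{1046}`);
* `base_cubeRoot` : `Base((3125/128)^{1/3})` — the design limit of the STAGE-2 twin class is ATTAINED by
  class certificates (a diagonal sequence), although by no single pencil member;
* `subexpSaturation_iff_base_cube_lt` : `SubexpSaturation ⟺ ∀ θ > 1, θ³ < 3125/128 → Base(θ)` — the
  open content of the crux is exactly the OPEN ray of grades `θ ∈ (1, (3125/128)^{1/3})`.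

Cell record (lens 1 «grading / quantitative ladder», gen 15; numerics `gen15/ceiling_probe2.py`): over the
whole real-relaxed parameter class of `omegaRect_one_tw_exact` the infimum of `(1−t)·log r` along `t → 1`
is `log((3125/128)^{1/3}) = 1.06505…` (per-level minima `1.0657 (j=24)`, `1.06542 (j=256)`,
`1.06515 (j=1024)`, `→ c₂⁺` like `c₂ + 0.1/j`, always at `n₅ = 0`, `n₁ ≈ n₃ → 3/2`), so with this file
the set of bases witnessed by the class is the closed ray `[(3125/128)^{1/3}, ∞)` modulo the in-class
lower bound, which is NOT claimed here (it is the cell's next kernel target, the BC9 ceiling theorem).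
No definitions, no named facts, no sorry.
-/

set_option linter.dupNamespace false
-- (single-conjunct summit: the namespace repeats `MatrixMultiplication`)

noncomputable section

namespace Summit.MatrixMultiplication.MatrixMultiplication.Theorems.SaturationLadderTwinEndpoint

open Literature.Computability.AlgebraicComplexity
open Summit.MatrixMultiplication.MatrixMultiplication.Theorems.SaturationLadderTwinExact
  (omegaRect_one_tw_exact)
open Summit.MatrixMultiplication.MatrixMultiplication.Theorems.SaturationLadderSubThreeSaturation
  (baseSaturation_of_certificates)
open Summit.MatrixMultiplication.MatrixMultiplication.Theses.SaturationLadder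
  (SubexpSaturation)
open Summit.MatrixMultiplication.MatrixMultiplication.Theorems.SaturationLadderBaseFamily
  (subexpSaturation_iff_forall_base)
open Summit.MatrixMultiplication.MatrixMultiplication.Theorems.SaturationLadderTwinCeilingPencil
open Summit.MatrixMultiplication.MatrixMultiplication.Theorems.SaturationLadderTwinCeiling
  (one_le_r r_le)

/-! ## The diagonal member `p_j = ⌈(30 + (5/2) j log(5/4)) / log 2⌉`, `q_j = j` -/

/-- `log(5/2) = log(5/4) + log 2`. [folklore] -/
theorem log_five_halves_eq : Real.log (5 / 2) = Real.log (5 / 4) + Real.log 2 := by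
  rw [show (5 / 2 : ℝ) = 5 / 4 * 2 by norm_num, Real.log_mul (by norm_num) (by norm_num)]

/-- `log(3125/128) = 3 log θ_c`, in the two forms used: `θ³ ≥ 3125/128` gives
`5 log(5/4) + 3 log 2 ≤ 3 log θ`. [folklore] -/
theorem three_log_ge_of_cube_ge {θ : ℝ} (hcube : (3125 : ℝ) / 128 ≤ θ ^ 3) :
    5 * Real.log (5 / 4) + 3 * Real.log 2 ≤ 3 * Real.log θ := by
  have h1 := Real.log_le_log (by norm_num) hcube
  rw [Real.log_pow, Real.log_div (by norm_num) (by norm_num)] at h1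
  have e5 : Real.log (3125 : ℝ) = 5 * Real.log (5 / 4) + 10 * Real.log 2 := by
    rw [show (3125 : ℝ) = (5 / 4) ^ 5 * 2 ^ 10 by norm_num, Real.log_mul (by norm_num) (by norm_num),
      Real.log_pow, Real.log_pow]
    push_cast; ring
  have e7 : Real.log (128 : ℝ) = 7 * Real.log 2 := by
    rw [show (128 : ℝ) = 2 ^ 7 by norm_num, Real.log_pow]; push_cast; ring
  rw [e5, e7] at h1; push_cast at h1; linarith

/-- `θ³ ≥ 3125/128`, `θ > 0` ⇒ `θ ≥ 1`. [folklore] -/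
theorem one_le_of_cube_ge {θ : ℝ} (hθ : 0 < θ) (hcube : (3125 : ℝ) / 128 ≤ θ ^ 3) : 1 ≤ θ := by
  by_contra h
  rw [not_le] at h
  have : θ ^ 3 < 1 := pow_lt_one₀ hθ.le h (by norm_num)
  linarith

/-- **The `Y`-threshold margin by construction**: `j · δ(p_j / j) ≥ 30`, where
`δ(κ) = (5/2 + κ) log 2 − (5/2) log(5/2)` — indeed `j · δ(p/j) = p log 2 − (5/2) j log(5/4)`.
[folklore] -/
theorem diag_delta (p j : ℕ) (hj : 0 < j)
    (hp : p = ⌈(30 + 5 / 2 * (j : ℝ) * Real.log (5 / 4)) / Real.log 2⌉₊) :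
    30 ≤ (j : ℝ) * ((5 / 2 + (p : ℝ) / j) * Real.log 2 - 5 / 2 * Real.log (5 / 2)) := by
  have hL2 : 0 < Real.log 2 := Real.log_pos one_lt_two
  have hj' : (0 : ℝ) < j := by exact_mod_cast hj
  have hpx : (30 + 5 / 2 * (j : ℝ) * Real.log (5 / 4)) / Real.log 2 ≤ (p : ℝ) := by
    rw [hp]; exact Nat.le_ceil _
  rw [div_le_iff₀ hL2] at hpx
  have hj0 : (j : ℝ) ≠ 0 := hj'.ne'
  have e : (j : ℝ) * ((5 / 2 + (p : ℝ) / j) * Real.log 2 - 5 / 2 * Real.log (5 / 2)) =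
      (p : ℝ) * Real.log 2 - 5 / 2 * (j : ℝ) * Real.log (5 / 4) := by
    rw [log_five_halves_eq]
    field_simp
    ring
  rw [e]
  linarith

/-- `p_j ≤ j` for `j ≥ 1000` (`log(5/4) ≤ 1/4`, `log 2 > 0.6931`; `j ≥ 451` would do). [folklore] -/
theorem diag_le (p j : ℕ) (hj : 1000 ≤ j)
    (hp : p = ⌈(30 + 5 / 2 * (j : ℝ) * Real.log (5 / 4)) / Real.log 2⌉₊) : p ≤ j := by
  have hl2 := Real.log_two_gt_d9
  have hL2 : 0 < Real.log 2 := by linarith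
  have hA : Real.log (5 / 4 : ℝ) ≤ 1 / 4 := by
    have := Real.log_le_sub_one_of_pos (by norm_num : (0 : ℝ) < 5 / 4); linarith
  have hA0 : 0 ≤ Real.log (5 / 4 : ℝ) := Real.log_nonneg (by norm_num)
  have hJ : (1000 : ℝ) ≤ j := by exact_mod_cast hj
  have hx0 : 0 ≤ (30 + 5 / 2 * (j : ℝ) * Real.log (5 / 4)) / Real.log 2 := by positivity
  have hpx : (p : ℝ) < (30 + 5 / 2 * (j : ℝ) * Real.log (5 / 4)) / Real.log 2 + 1 := by
    rw [hp]; exact Nat.ceil_lt_add_one hx0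
  have hxj : (30 + 5 / 2 * (j : ℝ) * Real.log (5 / 4)) / Real.log 2 ≤ (j : ℝ) - 1 := by
    rw [div_le_iff₀ hL2]
    have h1 : 5 / 2 * (j : ℝ) * Real.log (5 / 4) ≤ 5 / 2 * (j : ℝ) * (1 / 4) :=
      mul_le_mul_of_nonneg_left hA (by positivity)
    have h2 : 0.6931471803 * ((j : ℝ) - 1) ≤ Real.log 2 * ((j : ℝ) - 1) :=
      mul_le_mul_of_nonneg_right hl2.le (by linarith)
    nlinarith [h1, h2]
  have h : (p : ℝ) < j := by linarith
  exact (Nat.cast_lt.1 h).le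

/-- **Growth of the diagonal member against a base `θ` with `θ³ ≥ 3125/128`**:
`2^{j+2} ≤ 2^{46} · θ^{1/(1 − t_j)}` (`j ≥ 1000`), `t_j` the abscissa of the member `(p_j, j)` in the
form of `omegaRect_one_tw_exact` (`n₁ = 3j² + 2j`, `n₃ = 3j² + 2j + 2p_j`, `n₅ = 0`).  The exponent
comparison `(j − 44)(3j + 2p_j) log 2 ≤ j² (5 log(5/4) + 3 log 2)` uses only
`2 p_j log 2 ≤ 60 + 5 j log(5/4) + 2 log 2`. [folklore] -/
theorem diag_growth {θ : ℝ} (hθ : 0 < θ) (hcube : (3125 : ℝ) / 128 ≤ θ ^ 3) (p j n₁ n₃ : ℕ)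
    (hj : 1000 ≤ j) (hp : p = ⌈(30 + 5 / 2 * (j : ℝ) * Real.log (5 / 4)) / Real.log 2⌉₊)
    (h₁ : n₁ = 3 * j * j + 2 * j) (h₃ : n₃ = 3 * j * j + 2 * j + 2 * p) :
    (2 : ℝ) ^ (j + 2) ≤
      (2 : ℝ) ^ 46 * θ ^ (1 / (1 - ((j : ℝ) * n₁) / (((j : ℝ) + 1) * n₃ + ((0 : ℕ) : ℝ)))) := by
  have hq : 0 < j := by omega
  have hjE := nat_le_pencil_exponent p j j n₁ n₃ h₁ h₃ hq
  set E : ℝ := 1 / (1 - ((j : ℝ) * n₁) / (((j : ℝ) + 1) * n₃ + ((0 : ℕ) : ℝ))) with hE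
  have hl2 := Real.log_two_gt_d9
  have hL2 : 0 < Real.log 2 := by linarith
  have hA0 : 0 ≤ Real.log (5 / 4 : ℝ) := Real.log_nonneg (by norm_num)
  have hJ : (1000 : ℝ) ≤ j := by exact_mod_cast hj
  have hJ0 : (0 : ℝ) ≤ j := by positivity
  have hP0 : (0 : ℝ) ≤ p := Nat.cast_nonneg p
  have hθ1 : 1 ≤ θ := one_le_of_cube_ge hθ hcube
  have hΛ := three_log_ge_of_cube_ge hcube
  -- the ceiling bound on `p_j`: `p log 2 ≤ 30 + (5/2) j log(5/4) + log 2`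
  have hx0 : 0 ≤ (30 + 5 / 2 * (j : ℝ) * Real.log (5 / 4)) / Real.log 2 := by positivity
  have hPL : (p : ℝ) * Real.log 2 ≤ 30 + 5 / 2 * (j : ℝ) * Real.log (5 / 4) + Real.log 2 := by
    have hpx : (p : ℝ) < (30 + 5 / 2 * (j : ℝ) * Real.log (5 / 4)) / Real.log 2 + 1 := by
      rw [hp]; exact Nat.ceil_lt_add_one hx0
    rw [div_add_one hL2.ne', lt_div_iff₀ hL2] at hpx
    linarith
  -- the exponent of the member: `3j²/(3j + 2p) ≤ E`
  have hden : 0 < 3 * (j : ℝ) + 2 * p := by positivity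
  have hx'E : (3 * (j : ℝ) * j) / (3 * j + 2 * p) ≤ E := by
    rw [div_le_iff₀ hden]
    have h := hjE
    rw [div_mul_eq_mul_div, le_div_iff₀ (by positivity)] at h
    nlinarith [h]
  have hx'0 : 0 ≤ (3 * (j : ℝ) * j) / (3 * j + 2 * p) := by positivity
  -- `θ^E ≥ θ^{3j²/(3j+2p)} ≥ exp((3j²/(3j+2p)) · (5 log(5/4) + 3 log 2)/3)`
  have hpow1 : θ ^ ((3 * (j : ℝ) * j) / (3 * j + 2 * p)) ≤ θ ^ E :=
    Real.rpow_le_rpow_of_exponent_le hθ1 hx'E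
  have hexp1 : Real.exp ((3 * (j : ℝ) * j) / (3 * j + 2 * p) *
      ((5 * Real.log (5 / 4) + 3 * Real.log 2) / 3)) ≤ θ ^ ((3 * (j : ℝ) * j) / (3 * j + 2 * p)) := by
    rw [Real.rpow_def_of_pos hθ]
    exact Real.exp_le_exp.2 (by nlinarith [hΛ, hx'0])
  -- the exponent comparison
  have key : ((j : ℝ) + 2) * Real.log 2 ≤ 46 * Real.log 2 +
      (3 * (j : ℝ) * j) / (3 * j + 2 * p) * ((5 * Real.log (5 / 4) + 3 * Real.log 2) / 3) := by
    have e : (3 * (j : ℝ) * j) / (3 * j + 2 * p) * ((5 * Real.log (5 / 4) + 3 * Real.log 2) / 3) =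
        ((j : ℝ) * j * (5 * Real.log (5 / 4) + 3 * Real.log 2)) / (3 * j + 2 * p) := by
      field_simp
    rw [e, ← sub_le_iff_le_add', le_div_iff₀ hden]
    -- `((j+2) log 2 − 46 log 2)(3j + 2p) ≤ j² (5 log(5/4) + 3 log 2)`
    have h1 : 0 ≤ ((j : ℝ) - 44) * (30 + 5 / 2 * (j : ℝ) * Real.log (5 / 4) + Real.log 2 -
        (p : ℝ) * Real.log 2) := mul_nonneg (by linarith) (by linarith)
    have h2 : 0.6931471803 * (j : ℝ) ≤ Real.log 2 * j := mul_le_mul_of_nonneg_right hl2.le hJ0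
    have h3 : 0 ≤ (j : ℝ) * Real.log (5 / 4) := mul_nonneg hJ0 hA0
    nlinarith [h1, h2, h3, hL2.le]
  -- assemble
  have e2 : (2 : ℝ) ^ (j + 2) = Real.exp (((j : ℝ) + 2) * Real.log 2) := by
    rw [← Real.rpow_natCast 2 (j + 2), Real.rpow_def_of_pos two_pos]
    push_cast
    congr 1; ring
  have e46 : (2 : ℝ) ^ (46 : ℕ) = Real.exp (46 * Real.log 2) := by
    rw [← Real.rpow_natCast 2 46, Real.rpow_def_of_pos two_pos]
    push_cast
    congr 1; ring
  calc (2 : ℝ) ^ (j + 2) = Real.exp (((j : ℝ) + 2) * Real.log 2) := e2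
    _ ≤ Real.exp (46 * Real.log 2 + (3 * (j : ℝ) * j) / (3 * j + 2 * p) *
          ((5 * Real.log (5 / 4) + 3 * Real.log 2) / 3)) := Real.exp_le_exp.2 key
    _ = (2 : ℝ) ^ (46 : ℕ) * Real.exp ((3 * (j : ℝ) * j) / (3 * j + 2 * p) *
          ((5 * Real.log (5 / 4) + 3 * Real.log 2) / 3)) := by rw [Real.exp_add, e46]
    _ ≤ (2 : ℝ) ^ (46 : ℕ) * θ ^ ((3 * (j : ℝ) * j) / (3 * j + 2 * p)) :=
        mul_le_mul_of_nonneg_left hexp1 (by positivity)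
    _ ≤ (2 : ℝ) ^ 46 * θ ^ E := mul_le_mul_of_nonneg_left hpow1 (by positivity)

/-! ## The rung at the endpoint -/

/-- **`Base(θ)` for every `θ > 0` with `θ³ ≥ 3125/128`** — in particular at the twin-class ceiling
`(3125/128)^{1/3}` itself.  Certificates: `omegaRect_one_tw_exact` at the diagonal members
`(q, p) = (j, p_j)`, `j = 1000 + k`, i.e. counts `(3j² + 2j, 2j²·2^{j+1} − (3j² + 2j + 2p_j),
3j² + 2j + 2p_j, j² − 2j, 0, 2j²)`, entropy hypotheses `paramX` / `paramY` (margin `diag_delta`,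
`p_j ≤ j` by `diag_le`), growth `diag_growth`, assembled by `baseSaturation_of_certificates` with
`C = 2^{1046}`. [cite: CoppersmithWinograd1990, §8]
[cite: AlmanDuanVassilevskaWilliamsXuXuZhou2025, Thm. 3.2, §3.4] -/
theorem base_of_cube_ge {θ : ℝ} (hθ : 0 < θ) (hcube : (3125 : ℝ) / 128 ≤ θ ^ 3) :
    ∃ C : ℝ, ∀ t : ℝ, 0 ≤ t → t < 1 →
      ∃ r : ℝ, 1 ≤ r ∧ r ≤ C * θ ^ (1 / (1 - t)) ∧ omegaRect ℂ 1 t r ≤ 1 + r := by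
  have hθ1 : 1 ≤ θ := one_le_of_cube_ge hθ hcube
  -- the diagonal `p_j` as a sequence in `k`, `j = 1000 + k`
  obtain ⟨P, hP⟩ : ∃ P : ℕ → ℕ, ∀ k,
      P k = ⌈(30 + 5 / 2 * ((1000 + k : ℕ) : ℝ) * Real.log (5 / 4)) / Real.log 2⌉₊ :=
    ⟨fun k => ⌈(30 + 5 / 2 * ((1000 + k : ℕ) : ℝ) * Real.log (5 / 4)) / Real.log 2⌉₊, fun k => rfl⟩
  have hPle : ∀ k, P k ≤ 1000 + k := fun k => diag_le (P k) (1000 + k) (by omega) (hP k)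
  have hPδ : ∀ k, 30 ≤ ((1000 + k : ℕ) : ℝ) *
      ((5 / 2 + ((P k : ℕ) : ℝ) / ((1000 + k : ℕ) : ℝ)) * Real.log 2 - 5 / 2 * Real.log (5 / 2)) :=
    fun k => diag_delta (P k) (1000 + k) (by omega) (hP k)
  -- the two count equations with a subtraction, at `j = q = 1000 + k`, `p = P k`
  have hc₂ : ∀ k : ℕ,
      2 * (1000 + k) * (1000 + k) * 2 ^ (1000 + k + 1) - (3 * (1000 + k) * (1000 + k) +
        2 * (1000 + k) + 2 * P k) + (3 * (1000 + k) * (1000 + k) + 2 * (1000 + k) + 2 * P k) =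
        2 * (1000 + k) * (1000 + k) * 2 ^ (1000 + k + 1) := fun k =>
    Nat.sub_add_cancel (le_cnt_aux (P k) (1000 + k) (1000 + k) (hPle k) (by omega))
  have hc₄ : ∀ k : ℕ, (1000 + k) * (1000 + k) - 2 * (1000 + k) + 2 * (1000 + k) =
      (1000 + k) * (1000 + k) := fun k => Nat.sub_add_cancel (two_q_le (1000 + k) (1000 + k) (by omega))
  -- the abscissae and ordinates of the certificates, as sequences
  obtain ⟨t, ht⟩ : ∃ t : ℕ → ℝ, ∀ k, t k =
      (((1000 + k : ℕ) : ℝ) * ((3 * (1000 + k) * (1000 + k) + 2 * (1000 + k) : ℕ) : ℝ)) /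
        ((((1000 + k : ℕ) : ℝ) + 1) *
          ((3 * (1000 + k) * (1000 + k) + 2 * (1000 + k) + 2 * P k : ℕ) : ℝ) + ((0 : ℕ) : ℝ)) :=
    ⟨fun k => (((1000 + k : ℕ) : ℝ) * ((3 * (1000 + k) * (1000 + k) + 2 * (1000 + k) : ℕ) : ℝ)) /
        ((((1000 + k : ℕ) : ℝ) + 1) *
          ((3 * (1000 + k) * (1000 + k) + 2 * (1000 + k) + 2 * P k : ℕ) : ℝ) + ((0 : ℕ) : ℝ)),
      fun k => rfl⟩
  obtain ⟨r, hr⟩ : ∃ r : ℕ → ℝ, ∀ k, r k =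
      ((((1000 + k : ℕ) : ℝ) + 1) *
            ((2 * (1000 + k) * (1000 + k) * 2 ^ (1000 + k + 1) -
              (3 * (1000 + k) * (1000 + k) + 2 * (1000 + k) + 2 * P k) : ℕ) : ℝ) +
          ((3 * (1000 + k) * (1000 + k) + 2 * (1000 + k) : ℕ) : ℝ) +
          (((1000 + k) * (1000 + k) - 2 * (1000 + k) : ℕ) : ℝ)) /
        ((((1000 + k : ℕ) : ℝ) + 1) *
          ((3 * (1000 + k) * (1000 + k) + 2 * (1000 + k) + 2 * P k : ℕ) : ℝ) + ((0 : ℕ) : ℝ)) :=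
    ⟨fun k => ((((1000 + k : ℕ) : ℝ) + 1) *
            ((2 * (1000 + k) * (1000 + k) * 2 ^ (1000 + k + 1) -
              (3 * (1000 + k) * (1000 + k) + 2 * (1000 + k) + 2 * P k) : ℕ) : ℝ) +
          ((3 * (1000 + k) * (1000 + k) + 2 * (1000 + k) : ℕ) : ℝ) +
          (((1000 + k) * (1000 + k) - 2 * (1000 + k) : ℕ) : ℝ)) /
        ((((1000 + k : ℕ) : ℝ) + 1) *
          ((3 * (1000 + k) * (1000 + k) + 2 * (1000 + k) + 2 * P k : ℕ) : ℝ) + ((0 : ℕ) : ℝ)),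
      fun k => rfl⟩
  have hr1 : ∀ k, 1 ≤ r k := fun k => by
    rw [hr]
    exact one_le_r (P k) (1000 + k) (1000 + k) _ _ _ _ rfl (hc₂ k) rfl (hc₄ k) (by omega) (hPle k)
      (by omega)
  have hsat : ∀ k, omegaRect ℂ 1 (t k) (r k) ≤ 1 + r k := fun k => by
    rw [ht, hr]
    exact omegaRect_one_tw_exact (1000 + k) (3 * (1000 + k) * (1000 + k) + 2 * (1000 + k))
      (2 * (1000 + k) * (1000 + k) * 2 ^ (1000 + k + 1) -
        (3 * (1000 + k) * (1000 + k) + 2 * (1000 + k) + 2 * P k))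
      (3 * (1000 + k) * (1000 + k) + 2 * (1000 + k) + 2 * P k) ((1000 + k) * (1000 + k) - 2 * (1000 + k))
      0 (2 * (1000 + k) * (1000 + k))
      (cnt₆_pos (1000 + k) (1000 + k) (by omega) (by omega)) (cnt_add₁₄ (1000 + k) (1000 + k) (by omega))
      (cnt_add₂₃ (P k) (1000 + k) (1000 + k) (hPle k) (by omega)) (cnt₃_pos (P k) (1000 + k) (1000 + k) (by omega))
      (paramX (P k) (1000 + k) (1000 + k) _ _ _ _ _ (by omega) (hPle k) (by omega) (hPδ k) rfl (hc₂ k)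
        rfl (hc₄ k) rfl)
      (paramY (P k) (1000 + k) (1000 + k) _ _ _ _ _ (by omega) (hPle k) (by omega) (hPδ k) rfl (hc₂ k)
        rfl (hc₄ k) rfl)
  have hcov : ∀ s : ℝ, s < 1 → ∃ k, s ≤ t k := fun s hs => by
    -- the abscissae exhaust `[0,1)`: `1 − t_j ≤ 2/j`
    obtain ⟨k, hk⟩ := exists_nat_ge (2 / (1 - s))
    refine ⟨k, ?_⟩
    have h1s : 0 < 1 - s := by linarith
    have hjpos : (0 : ℝ) < ((1000 + k : ℕ) : ℝ) := by
      have : (1 : ℝ) ≤ ((1000 + k : ℕ) : ℝ) := by exact_mod_cast (by omega : 1 ≤ 1000 + k)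
      linarith
    have hle := one_sub_t_le (P k) (1000 + k) (1000 + k) (3 * (1000 + k) * (1000 + k) + 2 * (1000 + k))
      (3 * (1000 + k) * (1000 + k) + 2 * (1000 + k) + 2 * P k) rfl rfl (by omega) (hPle k) (by omega)
    have hk' : 2 / (1 - s) ≤ ((1000 + k : ℕ) : ℝ) :=
      hk.trans (by push_cast; linarith)
    have h2 : 2 / ((1000 + k : ℕ) : ℝ) ≤ 1 - s := by
      rw [div_le_iff₀ hjpos]
      have := (div_le_iff₀ h1s).1 hk'
      linarith
    rw [ht]
    linarith
  -- growth, with `C = 2^{1046}`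
  have hpos46 : (0 : ℝ) < (2 : ℝ) ^ 1046 := by positivity
  have h0 : r 0 ≤ θ * (2 : ℝ) ^ 1046 := by
    have h1 : r 0 ≤ (2 : ℝ) ^ (1000 + 0 + 1) := by
      rw [hr]
      exact r_le (P 0) (1000 + 0) (1000 + 0) _ _ _ _ rfl (hc₂ 0) rfl (hc₄ 0) (by omega) (by omega)
    have h2 : (2 : ℝ) ^ (1000 + 0 + 1) ≤ (2 : ℝ) ^ 1046 := pow_le_pow_right₀ (by norm_num) (by omega)
    have h3 : (2 : ℝ) ^ 1046 ≤ θ * (2 : ℝ) ^ 1046 := le_mul_of_one_le_left hpos46.le hθ1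
    exact h1.trans (h2.trans h3)
  have hstep : ∀ k, r (k + 1) ≤ (2 : ℝ) ^ 1046 * θ ^ (1 / (1 - t k)) := fun k => by
    have h1 : r (k + 1) ≤ (2 : ℝ) ^ (1000 + (k + 1) + 1) := by
      rw [hr]
      exact r_le (P (k + 1)) (1000 + (k + 1)) (1000 + (k + 1)) _ _ _ _ rfl (hc₂ (k + 1)) rfl
        (hc₄ (k + 1)) (by omega) (by omega)
    have h2 : (2 : ℝ) ^ (1000 + k + 2) ≤ (2 : ℝ) ^ 46 * θ ^ (1 / (1 - t k)) := by
      rw [ht]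
      exact diag_growth hθ hcube (P k) (1000 + k) _ _ (by omega) (hP k) rfl rfl
    have hpow : 0 < θ ^ (1 / (1 - t k)) := Real.rpow_pos_of_pos hθ _
    have h3 : (2 : ℝ) ^ 46 * θ ^ (1 / (1 - t k)) ≤ (2 : ℝ) ^ 1046 * θ ^ (1 / (1 - t k)) :=
      mul_le_mul_of_nonneg_right (pow_le_pow_right₀ (by norm_num) (by omega)) hpow.le
    rw [show 1000 + (k + 1) + 1 = 1000 + k + 2 from by omega] at h1
    exact h1.trans (h2.trans h3)
  exact ⟨(2 : ℝ) ^ 1046, baseSaturation_of_certificates θ ((2 : ℝ) ^ 1046) hθ1 t r hr1 hsat hcov h0 hstep⟩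

/-- **`Base((3125/128)^{1/3})`**: the design limit `(5⁵/2⁷)^{1/3} = 2.90099…` of the STAGE-2 twin class
is attained by class certificates. [cite: CoppersmithWinograd1990, §8]
[cite: AlmanDuanVassilevskaWilliamsXuXuZhou2025, Thm. 3.2, §3.4] -/
theorem base_cubeRoot :
    ∃ C : ℝ, ∀ t : ℝ, 0 ≤ t → t < 1 →
      ∃ r : ℝ, 1 ≤ r ∧ r ≤ C * (((3125 : ℝ) / 128) ^ ((1 : ℝ) / 3)) ^ (1 / (1 - t)) ∧
        omegaRect ℂ 1 t r ≤ 1 + r := by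
  have hcube : (((3125 : ℝ) / 128) ^ ((1 : ℝ) / 3)) ^ 3 = 3125 / 128 := by
    rw [show ((1 : ℝ) / 3) = ((3 : ℕ) : ℝ)⁻¹ by norm_num]
    exact Real.rpow_inv_natCast_pow (by norm_num) (by norm_num)
  exact base_of_cube_ge (Real.rpow_pos_of_pos (by norm_num) _) hcube.symm.le

/-- `2.9 < (3125/128)^{1/3} < 2.901` (cube comparison). [folklore] -/
theorem cubeRoot_window :
    (29 / 10 : ℝ) < ((3125 : ℝ) / 128) ^ ((1 : ℝ) / 3) ∧
      ((3125 : ℝ) / 128) ^ ((1 : ℝ) / 3) < 2901 / 1000 := by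
  have h3 : (0 : ℝ) < 1 / 3 := by norm_num
  constructor
  · have h : ((29 / 10 : ℝ) ^ (3 : ℕ)) ^ ((1 : ℝ) / 3) < ((3125 : ℝ) / 128) ^ ((1 : ℝ) / 3) :=
      Real.rpow_lt_rpow (by positivity) (by norm_num) h3
    rwa [← Real.rpow_natCast, ← Real.rpow_mul (show (0 : ℝ) ≤ 29 / 10 by norm_num),
      show ((3 : ℕ) : ℝ) * (1 / 3) = 1 by norm_num, Real.rpow_one] at h
  · have h : ((3125 : ℝ) / 128) ^ ((1 : ℝ) / 3) < ((2901 / 1000 : ℝ) ^ (3 : ℕ)) ^ ((1 : ℝ) / 3) :=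
      Real.rpow_lt_rpow (by positivity) (by norm_num) h3
    rwa [← Real.rpow_natCast (2901 / 1000 : ℝ), ← Real.rpow_mul (show (0 : ℝ) ≤ 2901 / 1000 by norm_num),
      show ((3 : ℕ) : ℝ) * (1 / 3) = 1 by norm_num, Real.rpow_one] at h

/-- **The open content of the crux, exactly**: `SubexpSaturation ⟺ ∀ θ > 1, θ³ < 3125/128 → Base(θ)` —
the OPEN ray of grades `θ ∈ (1, (3125/128)^{1/3})`; every grade `θ³ ≥ 3125/128` is a theorem
(`base_of_cube_ge`). [cite: AlmanDuanVassilevskaWilliamsXuXuZhou2025, §3.4] -/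
theorem subexpSaturation_iff_base_cube_lt :
    SubexpSaturation ↔ ∀ θ : ℝ, 1 < θ → θ ^ 3 < 3125 / 128 → ∃ C : ℝ, ∀ t : ℝ, 0 ≤ t → t < 1 →
      ∃ r : ℝ, 1 ≤ r ∧ r ≤ C * θ ^ (1 / (1 - t)) ∧ omegaRect ℂ 1 t r ≤ 1 + r := by
  refine ⟨fun h θ hθ _ => (subexpSaturation_iff_forall_base.1 h) θ hθ, fun h => ?_⟩
  rw [subexpSaturation_iff_forall_base]
  intro θ hθ
  by_cases hc : θ ^ 3 < 3125 / 128
  · exact h θ hθ hc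
  · exact base_of_cube_ge (by linarith) (not_lt.1 hc)

end Summit.MatrixMultiplication.MatrixMultiplication.Theorems.SaturationLadderTwinEndpoint
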